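import Mathlib.Analysis.Normed.Operator.Bilinear
import Mathlib.Analysis.InnerProductSpace.Basic
import Mathlib.Data.Matrix.Basic
import HarnessLib

/-!
# The maximum-point estimate for the difference of two solutions of a strictly parabolic
# system: the algebraic core
(topic `Geometry/Riemannian`)

Seventh layer of the DeTurck decomposition of the named fact
`Literature.Geometry.Riemannian.ricciFlow_uniqueness` (`RicciFlow.lean`; Hamilton 1982,
Thm. 5.1; Topping 2006, Thm. 5.2.2). Uniqueness for the Ricci–DeTurck flow on a closed manifold
(hypothesis (RU) of `RicciDeTurckReduction.lean`) is, in print, "the standard theory of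
partial differential equations" for the strictly parabolic system
`∂ₜg = -2 Ric(g) + ℒ_W g` (Andrews–Hopper 2011, §5.4.1–§5.4.2, Step 1; Topping 2006, §5.2,
Step 1). The tree proves it by the maximum principle in maximum-point form
(`MaximumPrincipleAtMaxima.lean`) applied to `u = |g₁ - g₂|²_h`; in a chart the system has the
quasilinear form `∂ₜG = Gi^{qp} ∂ₚ∂_q G + F(G, ∂G)` (`RicciDeTurckCoord.rdt_rhs_eq_coord`),
`u` has the coordinate form and calculus of `MetricNormSqCoord.lean`, and what remains at a
spatial maximum `y₀` of `u(t₀, ·)` is an inequality between finitely many numbers — the jets of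
the two solutions at `y₀`. This file PROVES that inequality (`JetEstimate.two_mul_ip_le`) in a
self-contained algebraic form: no manifolds, no functions, only a normed space `S` (the fibre of
forms), a finite index type `ι` (the basis), real constants and the hypotheses listing exactly
what the analysis uses. Everything is proved; no named fact and no `sorry` is introduced.

## Contents (all proved)

* `JetEstimate.IsSumOfSquares ip` — the pairing `ip` on `S` is a finite sum of squares of linear
  functionals (as is `⟨T, T'⟩_h = T_{ij}T'^{ij}` in an `h`-orthogonal frame,
  `normSq_eq_sum_sq`); consequences `comm`, `add_left`, `smul_left`, `sum_left`, `nonneg`, and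
  **`IsSumOfSquares.ellipticity`**: `λ ∑ₚ ip Tₚ Tₚ ≤ ∑ Gi_{qp} ip Tₚ T_q` whenever
  `λ |ξ|² ≤ Gi ξ ξ` on `ℝ^ι` (the coercivity of the good term of a strictly parabolic principal
  part against a positive semidefinite pairing).
* `young_aux` (`B h d ≤ λμ d² + (B²/4λμ) h²`), `estimateConst` (the explicit constant).
* **`JetEstimate.two_mul_ip_le`** — the maximum-point estimate `∂ₜu = 2 ip Ḣ H ≤ C u` from: the
  sum-of-squares, coercive and bounded pairing; ellipticity, symmetry and bounds of `Gi₁`;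
  `|Gi₁ - Gi₂| ≤ K ‖H‖`; bounded second derivatives of the second solution; the Leibniz expansion
  of the Hessian of `u` with bounded remainder and the MAXIMUM CONDITION `∑ Gi₁^{qp} ∂ₚ∂_q u ≤ 0`;
  and the splitting of `ip Ḣ H` given by the equation with a first-order remainder bounded by
  `K ‖H‖ (‖H‖ + ∑ ‖∂ₚH‖)`. See the docstring of the theorem for the precise list and the proof.

## References

* B. Andrews, C. Hopper, *The Ricci flow in Riemannian geometry*, LNM 2011, Springer 2011,
  §5.4.1, (5.9); §5.4.2, Step 1. [AndrewsHopper2011]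
* P. Topping, *Lectures on the Ricci flow*, LMS LNS 325 (2006), §5.2, Step 1; §3.1 (maximum
  principle). [Topping2006]
-/

noncomputable section

open Set Function Finset
open scoped BigOperators

namespace Literature.Geometry.Riemannian

namespace JetEstimate

variable {S : Type*} [NormedAddCommGroup S] [NormedSpace ℝ S] {ι : Type*} [Fintype ι]

/-! ### Pairings with a sum-of-squares representation -/

/-- A pairing `ip` on `S` **represented as a finite sum of squares of linear functionals**:
`ip T T' = ∑ₖ ℓₖ(T) ℓₖ(T')`. Such a pairing is bilinear, symmetric and positive semidefinite; the
metric pairing `⟨T, T'⟩_h = T_{ij} T'^{ij}` of bilinear forms is of this kind (sum over an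
`h`-orthogonal frame, `normSq_eq_sum_sq`). [folklore] -/
def IsSumOfSquares (ip : S → S → ℝ) : Prop :=
  ∃ (m : ℕ) (ℓ : Fin m → S →ₗ[ℝ] ℝ), ∀ T T', ip T T' = ∑ k, ℓ k T * ℓ k T'

variable {ip : S → S → ℝ}

/-- A sum-of-squares pairing is symmetric. [folklore] -/
theorem IsSumOfSquares.comm (h : IsSumOfSquares ip) (T T' : S) : ip T T' = ip T' T := by
  obtain ⟨m, ℓ, hℓ⟩ := h
  rw [hℓ, hℓ]
  exact Finset.sum_congr rfl fun k _ ↦ mul_comm _ _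

/-- A sum-of-squares pairing is additive in the first slot. [folklore] -/
theorem IsSumOfSquares.add_left (h : IsSumOfSquares ip) (T₁ T₂ T' : S) :
    ip (T₁ + T₂) T' = ip T₁ T' + ip T₂ T' := by
  obtain ⟨m, ℓ, hℓ⟩ := h
  simp only [hℓ, map_add, add_mul, Finset.sum_add_distrib]

/-- A sum-of-squares pairing is homogeneous in the first slot. [folklore] -/
theorem IsSumOfSquares.smul_left (h : IsSumOfSquares ip) (r : ℝ) (T T' : S) :
    ip (r • T) T' = r * ip T T' := by
  obtain ⟨m, ℓ, hℓ⟩ := h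
  simp only [hℓ, map_smul, smul_eq_mul, Finset.mul_sum]
  exact Finset.sum_congr rfl fun k _ ↦ by ring

/-- A sum-of-squares pairing is additive over finite sums in the first slot. [folklore] -/
theorem IsSumOfSquares.sum_left (h : IsSumOfSquares ip) {α : Type*} (s : Finset α)
    (T : α → S) (T' : S) : ip (∑ a ∈ s, T a) T' = ∑ a ∈ s, ip (T a) T' := by
  classical
  induction s using Finset.induction_on with
  | empty =>
    have h0 := h.smul_left 0 0 T'
    rw [zero_smul, zero_mul] at h0
    simpa using h0
  | insert a s ha ih => rw [Finset.sum_insert ha, Finset.sum_insert ha, h.add_left, ih]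

/-- A sum-of-squares pairing is positive semidefinite. [folklore] -/
theorem IsSumOfSquares.nonneg (h : IsSumOfSquares ip) (T : S) : 0 ≤ ip T T := by
  obtain ⟨m, ℓ, hℓ⟩ := h
  rw [hℓ]
  exact Finset.sum_nonneg fun k _ ↦ mul_self_nonneg _

/-- **Ellipticity against a sum-of-squares pairing.** If the symmetric matrix `Gi` is bounded
below by `λ` as a quadratic form on `ℝ^ι`, `λ ∑ ξₚ² ≤ ∑ Gi_{qp} ξₚ ξ_q`, then for every family
`Tₚ` in `S`, `λ ∑ₚ ip Tₚ Tₚ ≤ ∑_{p,q} Gi_{qp} ip Tₚ T_q` (apply the quadratic bound to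
`ξₚ = ℓₖ(Tₚ)` for each square `ℓₖ` and sum over `k`). This is the coercivity
`gᵖ𐞥 ⟨∂ₚH, ∂_qH⟩ ≥ λ |∂H|²` of the good term produced by a strictly parabolic principal part.
[folklore] -/
theorem IsSumOfSquares.ellipticity (h : IsSumOfSquares ip) {Gi : Matrix ι ι ℝ} {lam : ℝ}
    (hlam : ∀ ξ : ι → ℝ, lam * ∑ p, ξ p ^ 2 ≤ ∑ p, ∑ q, Gi q p * ξ p * ξ q) (T : ι → S) :
    lam * ∑ p, ip (T p) (T p) ≤ ∑ p, ∑ q, Gi q p * ip (T p) (T q) := by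
  obtain ⟨m, ℓ, hℓ⟩ := h
  simp only [hℓ]
  calc lam * ∑ p, ∑ k, ℓ k (T p) * ℓ k (T p)
      = ∑ k, lam * ∑ p, ℓ k (T p) ^ 2 := by
        rw [Finset.sum_comm, Finset.mul_sum]
        refine Finset.sum_congr rfl fun k _ ↦ ?_
        congr 1
        exact Finset.sum_congr rfl fun p _ ↦ (sq _).symm
    _ ≤ ∑ k, ∑ p, ∑ q, Gi q p * ℓ k (T p) * ℓ k (T q) :=
        Finset.sum_le_sum fun k _ ↦ hlam fun p ↦ ℓ k (T p)
    _ = ∑ p, ∑ q, Gi q p * ∑ k, ℓ k (T p) * ℓ k (T q) := by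
        rw [Finset.sum_comm]
        refine Finset.sum_congr rfl fun p _ ↦ ?_
        rw [Finset.sum_comm]
        refine Finset.sum_congr rfl fun q _ ↦ ?_
        rw [Finset.mul_sum]
        exact Finset.sum_congr rfl fun k _ ↦ by ring

/-! ### The estimate -/

/-- Young's inequality in the form used below: `B h d ≤ λμ d² + (B²/(4λμ)) h²` for `λμ > 0`.
[folklore] -/
theorem young_aux {lm B h d : ℝ} (hlm : 0 < lm) : B * h * d ≤ lm * d ^ 2 + B ^ 2 / (4 * lm) * h ^ 2 := by
  have key : 0 ≤ (2 * lm * d - B * h) ^ 2 := sq_nonneg _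
  have h4 : 0 < 4 * lm := by linarith
  have : 4 * lm * (B * h * d) ≤ 4 * lm * (lm * d ^ 2 + B ^ 2 / (4 * lm) * h ^ 2) := by
    rw [mul_add, show 4 * lm * (B ^ 2 / (4 * lm) * h ^ 2) = B ^ 2 * h ^ 2 by field_simp]
    nlinarith [key]
  exact le_of_mul_le_mul_left this h4

/-- The constant of `two_mul_ip_le`: with `n = |ι|`, `A = n² K₃ K₂ + 2 n² K₀ K₄ K₅ + 2 K₆`,
`B = 2 n K₁ K₃ + 2 K₆`, the constant is `(A + n B² / (4 λ μ)) / μ`. [folklore] -/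
def estimateConst (n K₀ K₁ K₂ K₃ K₄ K₅ K₆ lam μ : ℝ) : ℝ :=
  ((n ^ 2 * K₃ * K₂ + 2 * n ^ 2 * K₀ * K₄ * K₅ + 2 * K₆)
    + n * (2 * n * K₁ * K₃ + 2 * K₆) ^ 2 / (4 * (lam * μ))) / μ

/-- **The maximum-point estimate for the difference of two solutions of a quasilinear strictly
parabolic system — algebraic core.** Setting (all data at ONE point `y₀`, in a basis `b` indexed
by `ι`): a pairing `ip` on the space `S` of forms that is a sum of squares (the metric pairing
`⟨·,·⟩_{h(y₀)}`), coercive (`μ ‖T‖² ≤ ip T T`) and bounded (`|ip T T'| ≤ K₀ ‖T‖ ‖T'‖`); the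
inverse metrics `Gi₁`, `Gi₂` of the two solutions, `Gi₁` symmetric, elliptic (`λ |ξ|² ≤ Gi₁ ξ ξ`),
bounded (`|Gi₁| ≤ K₃`), and `|Gi₁ - Gi₂| ≤ K₄ ‖H‖` (Lipschitz dependence of the inverse on the
metric); the difference `H = G₁ - G₂` with first derivatives `dH p = ∂ₚH` and second derivatives
`D2H p q = ∂ₚ∂_qH`; the second derivatives `Q₂ p q = ∂ₚ∂_qG₂` of the second solution, bounded
by `K₅`; the values `Φ p q = ∂ₚ∂_q u` of the Hessian of `u = ip H H` at `y₀`, given by the Leibniz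
expansion `hnine` (`fderiv_fderiv_wsum_apply` of `MetricNormSqCoord.lean`) with a remainder
`rem` (derivatives falling on the coefficients of `ip`) bounded by
`K₂ ‖H‖² + K₁ ‖H‖ (‖∂ₚH‖ + ‖∂_qH‖)`, and satisfying the MAXIMUM CONDITION
`∑ Gi₁^{qp} ∂ₚ∂_q u ≤ 0` (`htr`: `tr_{g₁} D²u ≤ 0` at a spatial maximum); and the time derivative
`Hdot = ∂ₜH`, whose pairing with `H` splits (`hHdot`, from the coordinate form of the Ricci–DeTurck
equation, `rdt_rhs_eq_coord`: `∂ₜGᵢ = Giᵢ^{qp}∂ₚ∂_qGᵢ + F(Gᵢ, ∂Gᵢ)`) as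
`ip (Gi₁^{qp} ∂ₚ∂_qH) H + ip ((Gi₁ - Gi₂)^{qp} ∂ₚ∂_qG₂) H + fterm` with the first-order
remainder `|fterm| ≤ K₆ ‖H‖ (‖H‖ + ∑ ‖∂ₚH‖)` (local Lipschitz dependence of `F`).
CONCLUSION: `∂ₜu = 2 ip Hdot H ≤ C · ip H H = C u` with `C = estimateConst …` depending only on
the constants. Proof: the maximum condition turns `2 ip (Gi₁^{qp}∂ₚ∂_qH) H` into
`≤ -2 Gi₁^{qp} ip(∂ₚH, ∂_qH) + |Gi₁| |rem|`; ellipticity of `Gi₁` against the sum-of-squares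
pairing (`IsSumOfSquares.ellipticity`) and coercivity give the good term `-2λμ ∑ ‖∂ₚH‖²`, which
absorbs all cross terms `‖H‖ ‖∂ₚH‖` by Young's inequality, leaving `C ‖H‖² ≤ (C/μ) u`. This is
the pointwise heart of "uniqueness for the Ricci–DeTurck flow follows from the standard theory
of strictly parabolic equations" (Andrews–Hopper 2011, §5.4.2, Step 1; Topping 2006, §5.2).
[cite: AndrewsHopper2011, §5.4.2, Step 1] -/
theorem two_mul_ip_le (hip : IsSumOfSquares ip) {μ K₀ lam K₁ K₂ K₃ K₄ K₅ K₆ : ℝ}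
    (hμ : 0 < μ) (hlam : 0 < lam) (hK₀ : 0 ≤ K₀) (hK₂ : 0 ≤ K₂) (hK₃ : 0 ≤ K₃)
    (hK₄ : 0 ≤ K₄) (hK₅ : 0 ≤ K₅) (hK₆ : 0 ≤ K₆)
    (hcoer : ∀ T, μ * ‖T‖ ^ 2 ≤ ip T T) (hbd : ∀ T T', |ip T T'| ≤ K₀ * ‖T‖ * ‖T'‖)
    {Gi₁ Gi₂ : Matrix ι ι ℝ} (hsym : ∀ p q, Gi₁ p q = Gi₁ q p)
    (hell : ∀ ξ : ι → ℝ, lam * ∑ p, ξ p ^ 2 ≤ ∑ p, ∑ q, Gi₁ q p * ξ p * ξ q)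
    (hGi₁ : ∀ p q, |Gi₁ q p| ≤ K₃)
    {H Hdot : S} {dH : ι → S} {D2H Q₂ : ι → ι → S}
    (hGi : ∀ p q, |Gi₁ q p - Gi₂ q p| ≤ K₄ * ‖H‖) (hQ₂ : ∀ p q, ‖Q₂ p q‖ ≤ K₅)
    {Φ rem : ι → ι → ℝ} (htr : ∑ p, ∑ q, Gi₁ q p * Φ p q ≤ 0)
    (hnine : ∀ p q, Φ p q = ip (D2H p q) H + ip H (D2H p q) + ip (dH p) (dH q)
      + ip (dH q) (dH p) + rem p q)
    (hrem : ∀ p q, |rem p q| ≤ K₂ * ‖H‖ ^ 2 + K₁ * ‖H‖ * (‖dH p‖ + ‖dH q‖))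
    {fterm : ℝ}
    (hHdot : ip Hdot H = ip (∑ p, ∑ q, Gi₁ q p • D2H p q) H
      + ip (∑ p, ∑ q, (Gi₁ q p - Gi₂ q p) • Q₂ p q) H + fterm)
    (hf : |fterm| ≤ K₆ * ‖H‖ * (‖H‖ + ∑ p, ‖dH p‖)) :
    2 * ip Hdot H ≤ estimateConst (Fintype.card ι) K₀ K₁ K₂ K₃ K₄ K₅ K₆ lam μ * ip H H := by
  -- abbreviations
  set n : ℝ := (Fintype.card ι : ℝ) with hn
  set h : ℝ := ‖H‖ with hh
  set d : ι → ℝ := fun p ↦ ‖dH p‖ with hd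
  have hh0 : 0 ≤ h := norm_nonneg _
  have hd0 : ∀ p, 0 ≤ d p := fun p ↦ norm_nonneg _
  have hn0 : 0 ≤ n := by positivity
  have hsd0 : 0 ≤ ∑ p, d p := Finset.sum_nonneg fun p _ ↦ hd0 p
  have hcard : ∀ c : ℝ, ∑ _p : ι, c = n * c := fun c ↦ by
    rw [Finset.sum_const, Finset.card_univ, nsmul_eq_mul]
  -- Step 1: `ip` of the principal combination
  have hP : ip (∑ p, ∑ q, Gi₁ q p • D2H p q) H = ∑ p, ∑ q, Gi₁ q p * ip (D2H p q) H := by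
    rw [hip.sum_left]
    refine Finset.sum_congr rfl fun p _ ↦ ?_
    rw [hip.sum_left]
    exact Finset.sum_congr rfl fun q _ ↦ hip.smul_left _ _ _
  have h2P : 2 * ip (∑ p, ∑ q, Gi₁ q p • D2H p q) H =
      ∑ p, ∑ q, Gi₁ q p * (ip (D2H p q) H + ip H (D2H p q)) := by
    rw [hP, Finset.mul_sum]
    refine Finset.sum_congr rfl fun p _ ↦ ?_
    rw [Finset.mul_sum]
    refine Finset.sum_congr rfl fun q _ ↦ ?_
    rw [hip.comm H (D2H p q)]
    ring
  -- Step 2: the maximum condition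
  have hmax : ∑ p, ∑ q, Gi₁ q p * (ip (D2H p q) H + ip H (D2H p q)) ≤
      -(∑ p, ∑ q, Gi₁ q p * (ip (dH p) (dH q) + ip (dH q) (dH p)))
        - ∑ p, ∑ q, Gi₁ q p * rem p q := by
    have hsplit : ∑ p, ∑ q, Gi₁ q p * Φ p q =
        ∑ p, ∑ q, Gi₁ q p * (ip (D2H p q) H + ip H (D2H p q))
          + ∑ p, ∑ q, Gi₁ q p * (ip (dH p) (dH q) + ip (dH q) (dH p))
          + ∑ p, ∑ q, Gi₁ q p * rem p q := by
      simp only [← Finset.sum_add_distrib]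
      refine Finset.sum_congr rfl fun p _ ↦ Finset.sum_congr rfl fun q _ ↦ ?_
      rw [hnine]
      ring
    linarith [htr]
  -- Step 3: the good term
  have hgood : 2 * (lam * μ) * ∑ p, d p ^ 2 ≤
      ∑ p, ∑ q, Gi₁ q p * (ip (dH p) (dH q) + ip (dH q) (dH p)) := by
    have hsw : ∑ p, ∑ q, Gi₁ q p * ip (dH q) (dH p) = ∑ p, ∑ q, Gi₁ q p * ip (dH p) (dH q) := by
      rw [Finset.sum_comm]
      exact Finset.sum_congr rfl fun p _ ↦ Finset.sum_congr rfl fun q _ ↦ by rw [hsym]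
    have hsplit : ∑ p, ∑ q, Gi₁ q p * (ip (dH p) (dH q) + ip (dH q) (dH p)) =
        ∑ p, ∑ q, Gi₁ q p * ip (dH p) (dH q) + ∑ p, ∑ q, Gi₁ q p * ip (dH q) (dH p) := by
      simp only [mul_add, Finset.sum_add_distrib]
    have hell' := hip.ellipticity hell dH
    have hcoer' : μ * ∑ p, d p ^ 2 ≤ ∑ p, ip (dH p) (dH p) := by
      rw [Finset.mul_sum]
      exact Finset.sum_le_sum fun p _ ↦ hcoer (dH p)
    have h3 : lam * (μ * ∑ p, d p ^ 2) ≤ lam * ∑ p, ip (dH p) (dH p) :=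
      mul_le_mul_of_nonneg_left hcoer' hlam.le
    rw [hsplit, hsw]
    linarith
  -- Step 4: the remainder of the Hessian expansion
  have hremsum : |∑ p, ∑ q, Gi₁ q p * rem p q| ≤
      n ^ 2 * K₃ * K₂ * h ^ 2 + 2 * n * K₁ * K₃ * h * ∑ p, d p := by
    have hpq : ∀ p q, |Gi₁ q p * rem p q| ≤ K₃ * (K₂ * h ^ 2 + K₁ * h * (d p + d q)) := by
      intro p q
      rw [abs_mul]
      exact mul_le_mul (hGi₁ p q) (hrem p q) (abs_nonneg _) hK₃
    calc |∑ p, ∑ q, Gi₁ q p * rem p q|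
        ≤ ∑ p, ∑ q, |Gi₁ q p * rem p q| :=
          (Finset.abs_sum_le_sum_abs _ _).trans
            (Finset.sum_le_sum fun p _ ↦ Finset.abs_sum_le_sum_abs _ _)
      _ ≤ ∑ p, ∑ q, K₃ * (K₂ * h ^ 2 + K₁ * h * (d p + d q)) :=
          Finset.sum_le_sum fun p _ ↦ Finset.sum_le_sum fun q _ ↦ hpq p q
      _ = n ^ 2 * K₃ * K₂ * h ^ 2 + 2 * n * K₁ * K₃ * h * ∑ p, d p := by
          have e1 : ∀ p, ∑ q, K₃ * (K₂ * h ^ 2 + K₁ * h * (d p + d q)) =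
              n * (K₃ * (K₂ * h ^ 2 + K₁ * h * d p)) + K₃ * K₁ * h * ∑ q, d q := by
            intro p
            have : ∀ q, K₃ * (K₂ * h ^ 2 + K₁ * h * (d p + d q)) =
                K₃ * (K₂ * h ^ 2 + K₁ * h * d p) + K₃ * K₁ * h * d q := fun q ↦ by ring
            simp only [this, Finset.sum_add_distrib, hcard, ← Finset.mul_sum]
          simp only [e1, Finset.sum_add_distrib, hcard, ← Finset.mul_sum]
          ring
  -- Step 5: the term with `Gi₁ - Gi₂`
  have hR : |ip (∑ p, ∑ q, (Gi₁ q p - Gi₂ q p) • Q₂ p q) H| ≤ K₀ * (n ^ 2 * K₄ * K₅ * h) * h := by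
    have hnorm : ‖∑ p, ∑ q, (Gi₁ q p - Gi₂ q p) • Q₂ p q‖ ≤ n ^ 2 * K₄ * K₅ * h := by
      calc ‖∑ p, ∑ q, (Gi₁ q p - Gi₂ q p) • Q₂ p q‖
          ≤ ∑ p, ∑ q, ‖(Gi₁ q p - Gi₂ q p) • Q₂ p q‖ :=
            (norm_sum_le _ _).trans (Finset.sum_le_sum fun p _ ↦ norm_sum_le _ _)
        _ ≤ ∑ p, ∑ q, K₄ * h * K₅ := by
            refine Finset.sum_le_sum fun p _ ↦ Finset.sum_le_sum fun q _ ↦ ?_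
            rw [norm_smul, Real.norm_eq_abs]
            exact mul_le_mul (hGi p q) (hQ₂ p q) (norm_nonneg _) (by positivity)
        _ = n ^ 2 * K₄ * K₅ * h := by
            simp only [hcard]
            ring
    calc |ip (∑ p, ∑ q, (Gi₁ q p - Gi₂ q p) • Q₂ p q) H|
        ≤ K₀ * ‖∑ p, ∑ q, (Gi₁ q p - Gi₂ q p) • Q₂ p q‖ * h := hbd _ _
      _ ≤ K₀ * (n ^ 2 * K₄ * K₅ * h) * h := by gcongr
  -- Step 6: assemble the bound `2 ip Hdot H ≤ -2λμ Σ d² + A h² + B h Σ d`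
  set A : ℝ := n ^ 2 * K₃ * K₂ + 2 * n ^ 2 * K₀ * K₄ * K₅ + 2 * K₆ with hA
  set B : ℝ := 2 * n * K₁ * K₃ + 2 * K₆ with hB
  have hmain : 2 * ip Hdot H ≤ -(2 * (lam * μ) * ∑ p, d p ^ 2) + A * h ^ 2 + B * h * ∑ p, d p := by
    have e : 2 * ip Hdot H = ∑ p, ∑ q, Gi₁ q p * (ip (D2H p q) H + ip H (D2H p q))
        + 2 * ip (∑ p, ∑ q, (Gi₁ q p - Gi₂ q p) • Q₂ p q) H + 2 * fterm := by
      rw [hHdot, ← h2P]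
      ring
    rw [e]
    have h1 := abs_le.1 hremsum
    have h2 := abs_le.1 hR
    have h3 := abs_le.1 hf
    have h4 : K₆ * ‖H‖ * (‖H‖ + ∑ p, ‖dH p‖) = K₆ * h ^ 2 + K₆ * h * ∑ p, d p := by
      simp only [hh, hd]
      ring
    rw [h4] at h3
    nlinarith [hmax, hgood, h1.2, h2.2, h3.2]
  -- Step 7: Young's inequality absorbs the cross terms
  have hyoung : B * h * ∑ p, d p ≤
      (lam * μ) * ∑ p, d p ^ 2 + n * (B ^ 2 / (4 * (lam * μ))) * h ^ 2 := by
    have hy : ∀ p, B * h * d p ≤ lam * μ * d p ^ 2 + B ^ 2 / (4 * (lam * μ)) * h ^ 2 := fun p ↦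
      young_aux (mul_pos hlam hμ)
    calc B * h * ∑ p, d p = ∑ p, B * h * d p := Finset.mul_sum _ _ _
      _ ≤ ∑ p, (lam * μ * d p ^ 2 + B ^ 2 / (4 * (lam * μ)) * h ^ 2) :=
          Finset.sum_le_sum fun p _ ↦ hy p
      _ = (lam * μ) * ∑ p, d p ^ 2 + n * (B ^ 2 / (4 * (lam * μ))) * h ^ 2 := by
          rw [Finset.sum_add_distrib, ← Finset.mul_sum, hcard]
          ring
  -- Step 8: conclude
  have hA0 : 0 ≤ A := by positivity
  have hcoef : 0 ≤ A + n * B ^ 2 / (4 * (lam * μ)) :=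
    add_nonneg hA0 (div_nonneg (mul_nonneg hn0 (sq_nonneg B)) (by positivity))
  have hH2 : h ^ 2 ≤ ip H H / μ := by
    rw [le_div_iff₀ hμ]
    have := hcoer H
    linarith
  have hsq0 : 0 ≤ (lam * μ) * ∑ p, d p ^ 2 :=
    mul_nonneg (mul_pos hlam hμ).le (Finset.sum_nonneg fun p _ ↦ sq_nonneg _)
  have hstep : 2 * ip Hdot H ≤ -(lam * μ * ∑ p, d p ^ 2) + (A + n * B ^ 2 / (4 * (lam * μ))) * h ^ 2 := by
    have e : (A + n * B ^ 2 / (4 * (lam * μ))) * h ^ 2 =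
        A * h ^ 2 + n * (B ^ 2 / (4 * (lam * μ))) * h ^ 2 := by ring
    rw [e]
    linarith [hmain, hyoung]
  calc 2 * ip Hdot H
      ≤ (A + n * B ^ 2 / (4 * (lam * μ))) * h ^ 2 := by linarith [hstep, hsq0]
    _ ≤ (A + n * B ^ 2 / (4 * (lam * μ))) * (ip H H / μ) :=
        mul_le_mul_of_nonneg_left hH2 hcoef
    _ = estimateConst (Fintype.card ι) K₀ K₁ K₂ K₃ K₄ K₅ K₆ lam μ * ip H H := by
        simp only [estimateConst, hA, hB, hn]
        ring

end JetEstimate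

end Literature.Geometry.Riemannian

end
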